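/-
Origin: expansion seat `planner-pub-hodgecm-pv06-g2-0`, handover (c) 2026-08-18T05:37:48Z (`HOME/pub-hodgecm-pv06-g2/lean/Pv06g2/AnnihilationDense.lean`, md5 dcf653d1, 126 lines);
landed by the gen-6 packager in gate run 23 as `HodgeCM/PerL34/AnnihilationDense.lean` (import ^import Pv06g2\.Mirror\.→import HodgeCM.Literature. ×1; import ^import Pv[0-9]+g[0-9]+\.→import HodgeCM.PerL34. ×1).
-/
/-
Origin: pub-hodgecm cell, unit pub-hodgecm-pv06-g2 (DAG-NODE PROVER #06, generation 2), 2026-08-18.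
Target path in the package: `HodgeCM/PerL34/AnnihilationDense.lean`
(WIP imports: `Pv06g2.Mirror.RealApproximationUnitary` ↦ `HodgeCM.Literature.RealApproximationUnitary` — the WIP module
 is a one-line shim re-exporting `Pv06g2/RealApproximationUnitary.lean`, whose landed module is
 `HodgeCM.Literature.RealApproximationUnitary`; `Pv06g2.DenseOrbit` ↦ `HodgeCM.PerL34.DenseOrbit`).

# N23c `dense` — the assembled kernel form (PerL v5, Prop. 3.6 Step 2, ll. 430–433)

The `[PRINT]` field `dense` of `HodgeCM.PerL34.Annihilation.AnnihilationDatum` (Annihilation.lean:310),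

  `dense : Dense {g : G | ∃ γ ∈ Γ, ∃ (t : TA) (hf : Gf), g = γ * ιA t * ιf hf}`   (G = U(W)(𝔸), Γ = U(W)(L₀)),

is derived here, in its verbatim shape, from EXACTLY the following dictionary data (FACTS §0 class D, item D3 —
the standard description of the adelic points of the L₀-group `U(W)`, `W` the hermitian PLANE of PerL l. 314 with
Gram matrix `Hm` over the CM field `L`, `σ = conjRingHomK L`):

* `e : G ≃ₜ* U∞ × Gf` — `U(W)(𝔸) ≅ U(W)(L₀ ⊗ ℝ) × U(W)(𝔸_f)` as topological groups, where the archimedean factor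
  IS the concrete topological group `U∞ := unitaryPiSubmonoid L Hm` = the families `(u_w)_{w ∣ ∞}` of complex
  matrices with `u_wᴴ H^{w} u_w = H^{w}` (product topology; a group by `unitaryPiGroup`);
* `hιf : ∀ k, e (ιf k) = (1, k)` — `ιf` is the inclusion of the finite-adelic factor;
* `hΓ : ∀ g ∈ unitaryGroup σ Hm, ∃ γ ∈ Γ, (e γ).1 = (g^{w})_w` — every `L₀`-rational point of `U(W)` is (the
  archimedean component of) an element of `Γ`.

Everything else is KERNEL: real approximation for `U(H)` at all archimedean places
(`HodgeCM.Literature.RealApproximation.unitaryPi_mem_closure` / `RealApproximation_UH_holds`, file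
`RealApproximationUnitary.lean`, on top of cf-hasseminkowski-g4's `RealApproximation.lean`) and the two-line deduction
of the tex (`HodgeCM.PerL34.DenseOrbit.dense_of_realApproximation`).  Nothing cited, nothing posited; standard axioms.
-/
import Summits.HodgeConjecture.HodgeCM.Literature.RealApproximationUnitary
import Summits.HodgeConjecture.HodgeCM.PerL34.DenseOrbit

/-! PORT of `HodgeCM/PerL34/AnnihilationDense.lean` (HodgeCMPerL run 82) — verbatim mechanical port; provenance in the PORT header line. -/

open NumberField NumberField.InfinitePlace Topology Matrix
open Literature.AlgebraicGeometry.ShimuraVarieties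

namespace HodgeCM.Literature.RealApproximation

variable (L : CMField) {m : Type*} [Fintype m] [DecidableEq m] (Hm : Matrix m m L)

/-- `U(H)(L₀ ⊗ ℝ) = ∏_{w∣∞} U(H^{w})` as a topological monoid: the unitary families, a submonoid of the product
monoid of matrix families (carrier = `unitaryPiSet L Hm`). -/
def unitaryPiSubmonoid : Submonoid (InfinitePlace L → Matrix m m ℂ) where
  carrier := unitaryPiSet L Hm
  mul_mem' {u v} hu hv := by
    intro w
    have hu' := hu w
    have hv' := hv w
    simp only [Pi.mul_apply, conjTranspose_mul]
    calc (v w)ᴴ * (u w)ᴴ * Hm.map w.embedding * (u w * v w)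
        = (v w)ᴴ * ((u w)ᴴ * Hm.map w.embedding * u w) * v w := by simp only [Matrix.mul_assoc]
      _ = Hm.map w.embedding := by rw [hu', hv']
  one_mem' := by
    intro w
    simp

/-- (Ported verbatim from the HodgeCMPerL package; no docstring in the source.) -/
theorem mem_unitaryPiSubmonoid_iff (u : InfinitePlace L → Matrix m m ℂ) :
    u ∈ unitaryPiSubmonoid L Hm ↔ ∀ w, (u w)ᴴ * Hm.map w.embedding * u w = Hm.map w.embedding := Iff.rfl

/-- (Ported verbatim from the HodgeCMPerL package; no docstring in the source.) -/
@[simp] theorem coe_unitaryPiSubmonoid :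
    (unitaryPiSubmonoid L Hm : Set (InfinitePlace L → Matrix m m ℂ)) = unitaryPiSet L Hm := rfl

/-- The inverse family `w ↦ (H^{w})⁻¹ u_wᴴ H^{w}`. -/
noncomputable def invFamily (u : InfinitePlace L → Matrix m m ℂ) : InfinitePlace L → Matrix m m ℂ :=
  fun w => (Hm.map w.embedding)⁻¹ * (u w)ᴴ * Hm.map w.embedding

/-- (Ported verbatim from the HodgeCMPerL package; no docstring in the source.) -/
theorem invFamily_mul (hdet : IsUnit Hm.det) {u : InfinitePlace L → Matrix m m ℂ}
    (hu : u ∈ unitaryPiSubmonoid L Hm) (w : InfinitePlace L) : invFamily L Hm u w * u w = 1 := by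
  have hdw : IsUnit (Hm.map w.embedding).det := isUnit_det_map L Hm hdet w.embedding
  calc (Hm.map w.embedding)⁻¹ * (u w)ᴴ * Hm.map w.embedding * u w
      = (Hm.map w.embedding)⁻¹ * ((u w)ᴴ * Hm.map w.embedding * u w) := by simp only [Matrix.mul_assoc]
    _ = 1 := by rw [hu w, Matrix.nonsing_inv_mul _ hdw]

/-- (Ported verbatim from the HodgeCMPerL package; no docstring in the source.) -/
theorem mul_invFamily (hdet : IsUnit Hm.det) {u : InfinitePlace L → Matrix m m ℂ}
    (hu : u ∈ unitaryPiSubmonoid L Hm) (w : InfinitePlace L) : u w * invFamily L Hm u w = 1 :=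
  mul_eq_one_comm.mp (invFamily_mul L Hm hdet hu w)

/-- (Ported verbatim from the HodgeCMPerL package; no docstring in the source.) -/
theorem invFamily_mem (hdet : IsUnit Hm.det) {u : InfinitePlace L → Matrix m m ℂ}
    (hu : u ∈ unitaryPiSubmonoid L Hm) : invFamily L Hm u ∈ unitaryPiSubmonoid L Hm := by
  intro w
  have h1 : u w * invFamily L Hm u w = 1 := mul_invFamily L Hm hdet hu w
  calc (invFamily L Hm u w)ᴴ * Hm.map w.embedding * invFamily L Hm u w
      = (invFamily L Hm u w)ᴴ * ((u w)ᴴ * Hm.map w.embedding * u w) * invFamily L Hm u w := by rw [hu w]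
    _ = (u w * invFamily L Hm u w)ᴴ * Hm.map w.embedding * (u w * invFamily L Hm u w) := by
        simp only [conjTranspose_mul, Matrix.mul_assoc]
    _ = Hm.map w.embedding := by rw [h1]; simp

/-- For non-degenerate `H` every unitary family is invertible inside the monoid, so `U(H)(L₀ ⊗ ℝ)` is a
(topological) group.  Kept as a `def` (it depends on the hypothesis `IsUnit Hm.det`); use with `letI`. -/
@[reducible] noncomputable def unitaryPiGroup (hdet : IsUnit Hm.det) : Group (unitaryPiSubmonoid L Hm) :=
  { (inferInstance : Monoid (unitaryPiSubmonoid L Hm)) with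
    inv := fun u => ⟨invFamily L Hm u, invFamily_mem L Hm hdet u.2⟩
    inv_mul_cancel := fun u => Subtype.ext (funext fun w => by
      simpa only [Submonoid.coe_mul, Pi.mul_apply, Submonoid.coe_one, Pi.one_apply] using
        invFamily_mul L Hm hdet u.2 w) }

/-- **N23c `dense`, assembled.**  With `U∞ = unitaryPiSubmonoid L Hm` made a group by `unitaryPiGroup`, the
dictionary (`e`, `hιf`, `hΓ`) gives the verbatim field of `AnnihilationDatum` — real approximation and the coset
argument being kernel theorems. -/
theorem dense_cosets_of_dictionary (hH : (Hm.map (conjRingHomK L))ᵀ = Hm) (hdet : IsUnit Hm.det)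
    {G Gf : Type*} [Group G] [TopologicalSpace G] [Group Gf] [TopologicalSpace Gf]
    (e : G ≃ₜ* (unitaryPiSubmonoid L Hm) × Gf)
    (Γ : Subgroup G) (ιf : Gf →* G) (hιf : ∀ k : Gf, e (ιf k) = (1, k))
    (hΓ : ∀ g : GL m L, g ∈ unitaryGroup (conjRingHomK L) Hm →
      ∃ γ ∈ Γ, ((e γ).1 : InfinitePlace L → Matrix m m ℂ) = piMap L (g : Matrix m m L))
    {TA : Type*} (ιA : TA → G) (t₀ : TA) :
    Dense {g : G | ∃ γ ∈ Γ, ∃ (t : TA) (k : Gf), g = γ * ιA t * ιf k} := by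
  letI := unitaryPiGroup L Hm hdet
  refine HodgeCM.PerL34.DenseOrbit.dense_of_realApproximation e Γ ιf hιf
    (Subtype.val : unitaryPiSubmonoid L Hm → (InfinitePlace L → Matrix m m ℂ)) Topology.IsInducing.subtypeVal
    (fun g : unitaryGroup (conjRingHomK L) Hm => piMap L ((g : GL m L) : Matrix m m L)) ?_ ?_ ιA t₀
  · intro g
    exact hΓ g g.2
  · rintro _ ⟨u, rfl⟩
    have hset : {x : InfinitePlace L → Matrix m m ℂ |
        ∃ g : GL m L, g ∈ unitaryGroup (conjRingHomK L) Hm ∧ piMap L (g : Matrix m m L) = x} =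
        Set.range (fun g : unitaryGroup (conjRingHomK L) Hm => piMap L ((g : GL m L) : Matrix m m L)) := by
      ext x
      constructor
      · rintro ⟨g, hg, rfl⟩
        exact ⟨⟨g, hg⟩, rfl⟩
      · rintro ⟨g, rfl⟩
        exact ⟨g, g.2, rfl⟩
    rw [← hset]
    exact unitaryPi_mem_closure L Hm hH hdet (u : InfinitePlace L → Matrix m m ℂ) u.2

end HodgeCM.Literature.RealApproximation
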